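import Summits.Ventures.PercRepro.PerFlatHall

/-!
# PercRepro — the SHADOW form of C-025: Hall with CONTAINMENT adjacency (night-2, gen 5)

`PerFlatHall.lean` (night-4) records C-029: the per-flat route of C-025 is the Hall condition `Hall M p q Φ`
on the adjacency «`S ∩ G` has rank `q`» between the rank-`q` flats and the middle-level sets.  This file
records the STRONGER statement that an injection / matching proof of C-025 would have to produce — Hall's
condition on the CONTAINMENT relation `B ⊆ S` between the bottom sets `Uq M p q` and the middle level
`Yq M p q`:

* `shadow M p q 𝒜` = the middle-level sets containing some member of the family `𝒜` (its upper shadow in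
  the band `q < ρ < p`); `ShadowHall M p q c` = «`c · #𝒜 ≤ #shadow(𝒜)` for every `𝒜 ⊆ Uq M p q`»;
* `hall_of_shadowHall`: `ShadowHall M p q c → Hall M p q c` (`B ⊆ S` forces `ρ(S ∩ cl B) = q`), hence
  `c025_of_shadowHall`: the shadow condition at `Φ(p, q)` gives the body of `C025` on `M`;
* `shadowLevel`, `ShadowHallLevel`: the level-wise form (`#{S : ρ(S) = u, S ⊇ some B ∈ 𝒜}`);
* **`ShadowC025` / `ShadowC025Level`** — the two statements of record of this lane (conjectures; census in
  `proofs/NIGHT-2-shadow.md`: every matroid on ≤ 8 elements, every `(p, q)` — 0 / 6,738 sum-form and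
  0 / 13,621 level-wise failures, one max-flow each; the q ≥ 10 stars on which every fixed per-flat rule fails);
* **`shadow_card_of_notMem_closure`** (THEOREM, the «e-lemma»): at the diagonal `(q + 2, q)`, every family
  `𝒜 ⊆ Uq` whose closures miss some ground element `e` satisfies the shadow condition with the constant
  `Φ(q + 2, q) = (q + 2)/(q + 1)`: the sets `B ∪ {e}` are pairwise distinct middle-level sets, and the sets
  `B ∪ {z}` (`z ∉ cl B`, `z ≠ e`) are middle-level sets avoiding `e` with at most `q + 1` preimages each (a
  preimage is determined by a coloop `z` of `M|S`, and the coloops of `S` form an independent set).  So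
  `#shadow ≥ #𝒜 + #𝒜/(q + 1)`.  The families whose closures cover the ground set are the open case.
-/

namespace PercRepro.Shadow

open Finset PerFlat ThmH

variable {α : Type*} [DecidableEq α] {M : Matroid α} [M.Finite]

/-! ## The shadow of a family in the middle level -/

open scoped Classical in
/-- The upper shadow of the family `𝒜` in the middle level `Yq M p q`: the sets `S` with `q < ρ(S) < p`
containing some member of `𝒜`. -/
noncomputable def shadow (M : Matroid α) [M.Finite] (p q : ℕ) (𝒜 : Finset (Finset α)) : Finset (Finset α) :=
  (Yq M p q).filter (fun S => ∃ B ∈ 𝒜, B ⊆ S)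

open scoped Classical in
/-- Membership in `shadow`. -/
theorem mem_shadow {p q : ℕ} {𝒜 : Finset (Finset α)} {S : Finset α} :
    S ∈ shadow M p q 𝒜 ↔ S ∈ Yq M p q ∧ ∃ B ∈ 𝒜, B ⊆ S := by
  unfold shadow
  rw [Finset.mem_filter]

/-- `shadow ⊆ Yq`. -/
theorem shadow_subset_Yq {p q : ℕ} (𝒜 : Finset (Finset α)) : shadow M p q 𝒜 ⊆ Yq M p q :=
  fun _ hS => (mem_shadow.1 hS).1

/-- The shadow is monotone in the family. -/
theorem shadow_mono {p q : ℕ} {𝒜 ℬ : Finset (Finset α)} (h : 𝒜 ⊆ ℬ) : shadow M p q 𝒜 ⊆ shadow M p q ℬ := by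
  intro S hS
  rw [mem_shadow] at hS ⊢
  obtain ⟨hY, B, hB, hBS⟩ := hS
  exact ⟨hY, B, h hB, hBS⟩

/-- **The shadow Hall condition**: `c · #𝒜 ≤ #shadow(𝒜)` for every sub-family `𝒜` of the bottom sets. -/
def ShadowHall (M : Matroid α) [M.Finite] (p q : ℕ) (c : ℚ) : Prop :=
  ∀ 𝒜 ⊆ Uq M p q, c * (𝒜.card : ℚ) ≤ ((shadow M p q 𝒜).card : ℚ)

open scoped Classical in
/-- The rank-`u` subsets of the ground set. -/
noncomputable def levelSet (M : Matroid α) [M.Finite] (u : ℕ) : Finset (Finset α) :=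
  (gr M).powerset.filter (fun S => M.eRk (S : Set α) = (u : ℕ∞))

open scoped Classical in
/-- The upper shadow of `𝒜` at the rank level `u`. -/
noncomputable def shadowLevel (M : Matroid α) [M.Finite] (u : ℕ) (𝒜 : Finset (Finset α)) :
    Finset (Finset α) :=
  (levelSet M u).filter (fun S => ∃ B ∈ 𝒜, B ⊆ S)

/-- **The level-wise shadow Hall condition** at the level `u` with constant `c`. -/
def ShadowHallLevel (M : Matroid α) [M.Finite] (p q u : ℕ) (c : ℚ) : Prop :=
  ∀ 𝒜 ⊆ Uq M p q, c * (𝒜.card : ℚ) ≤ ((shadowLevel M u 𝒜).card : ℚ)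

/-- **THE SHADOW FORM OF C-025** (statement of record of the night-2 lane, gen 5; a conjecture): for every
finite matroid and `q + 2 ≤ p`, every sub-family `𝒜` of the bottom sets has at least `Φ(p, q) · #𝒜` middle-level
sets above it.  With `𝒜 = Uq` this is the body of `C025` (`c025_of_shadowHall`); it is strictly stronger than
C-029 (`hall_of_shadowHall`). -/
def ShadowC025 : Prop :=
  ∀ {α : Type} [DecidableEq α] (M : Matroid α) [M.Finite] (p q : ℕ), q + 2 ≤ p → ShadowHall M p q (phiK p q)

/-- **THE LEVEL-WISE SHADOW FORM OF C-025** (a conjecture): for `q < u < p`, every sub-family `𝒜` of the bottom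
sets has at least `C(p+q, u)/C(p+q, p) · #𝒜` rank-`u` sets above it. -/
def ShadowC025Level : Prop :=
  ∀ {α : Type} [DecidableEq α] (M : Matroid α) [M.Finite] (p q u : ℕ), q < u → u < p →
    ShadowHallLevel M p q u (((p + q).choose u : ℚ) / ((p + q).choose p : ℚ))

/-! ## The shadow condition implies the Hall condition of the per-flat route, hence C-025 -/

open scoped Classical in
/-- A bottom set `B ⊆ S` makes `cl B` adjacent to `S`: `ρ(S ∩ cl B) = q`. -/
theorem adj_clF_of_subset {p q : ℕ} {B S : Finset α} (hB : B ∈ Uq M p q) (hBS : B ⊆ S) :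
    Adj M q (clF M B) S := by
  unfold Adj
  have hBcl : B ⊆ clF M B := subset_clF hB
  have h1 : B ⊆ S ∩ clF M B := Finset.subset_inter hBS hBcl
  have h2 : (S ∩ clF M B : Finset α) ⊆ clF M B := Finset.inter_subset_right
  have hq : M.eRk (B : Set α) = (q : ℕ∞) := (mem_Uq.1 hB).2.1
  have hcl : M.eRk ((clF M B : Finset α) : Set α) = (q : ℕ∞) := by
    rw [coe_clF, M.eRk_closure_eq, hq]
  apply le_antisymm
  · calc M.eRk ((S ∩ clF M B : Finset α) : Set α) ≤ M.eRk ((clF M B : Finset α) : Set α) :=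
          M.eRk_mono (by exact_mod_cast h2)
      _ = (q : ℕ∞) := hcl
  · calc (q : ℕ∞) = M.eRk (B : Set α) := hq.symm
      _ ≤ M.eRk ((S ∩ clF M B : Finset α) : Set α) := M.eRk_mono (by exact_mod_cast h1)

open scoped Classical in
/-- `ShadowHall M p q c → Hall M p q c`: the shadow of the bottom sets of a family of flats lies in its
neighbourhood. -/
theorem hall_of_shadowHall {p q : ℕ} {c : ℚ} (h : ShadowHall M p q c) : Hall M p q c := by
  intro 𝒢 _
  have hsub : UqFam M p q 𝒢 ⊆ Uq M p q := fun B hB => (mem_UqFam.1 hB).1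
  have h1 := h (UqFam M p q 𝒢) hsub
  have h2 : shadow M p q (UqFam M p q 𝒢) ⊆ nbhd M p q 𝒢 := by
    intro S hS
    rw [mem_shadow] at hS
    obtain ⟨hY, B, hB, hBS⟩ := hS
    rw [mem_UqFam] at hB
    rw [mem_nbhd]
    exact ⟨hY, clF M B, hB.2, adj_clF_of_subset hB.1 hBS⟩
  calc c * ((UqFam M p q 𝒢).card : ℚ) ≤ ((shadow M p q (UqFam M p q 𝒢)).card : ℚ) := h1
    _ ≤ ((nbhd M p q 𝒢).card : ℚ) := by exact_mod_cast Finset.card_le_card h2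

/-- **The shadow condition at `Φ(p, q)` gives the body of `C025` on `M`.** -/
theorem c025_of_shadowHall {p q : ℕ} (h : ShadowHall M p q (phiK p q)) :
    phiK p q * ({A : Set α | A ⊆ M.E ∧ M.eRk A = (p : ℕ∞) ∧ M.eRk (M.E \ A) = (q : ℕ∞)}.ncard : ℚ) ≤
      ({A : Set α | A ⊆ M.E ∧ (q : ℕ∞) < M.eRk A ∧ M.eRk A < (p : ℕ∞)}.ncard : ℚ) :=
  c025_of_hall (hall_of_shadowHall h)

/-- `ShadowC025 → C025`. -/
theorem C025_of_shadowC025 (h : ShadowC025) : C025 := by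
  intro α M _ p q hpq
  classical
  exact c025_of_shadowHall (h M p q hpq)

/-! ## The e-lemma at the diagonal: families whose closures miss an element -/

/-- The coloops of `M|S`, as a finset: the `z ∈ S` with `z ∉ cl(S ∖ {z})`. -/
noncomputable def coloops (M : Matroid α) [M.Finite] (S : Finset α) : Finset α :=
  S.filter (fun z => z ∉ clF M (S.erase z))

/-- Membership in `coloops`. -/
theorem mem_coloops {S : Finset α} {z : α} : z ∈ coloops M S ↔ z ∈ S ∧ z ∉ clF M (S.erase z) := by
  unfold coloops
  rw [Finset.mem_filter]

/-- The coloops of `S` form an independent set. -/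
theorem indep_coloops {S : Finset α} (hS : S ⊆ gr M) : M.Indep ((coloops M S : Finset α) : Set α) := by
  have hsubE : ((coloops M S : Finset α) : Set α) ⊆ M.E := by
    rw [← coe_gr]
    exact_mod_cast (Finset.filter_subset _ S).trans hS
  rw [Matroid.indep_iff_forall_notMem_closure_sdiff hsubE]
  intro z hz hzcl
  have hz' : z ∈ coloops M S := by exact_mod_cast hz
  rw [mem_coloops] at hz'
  apply hz'.2
  rw [← Finset.mem_coe, coe_clF]
  have hsub : ((coloops M S : Finset α) : Set α) \ {z} ⊆ ((S.erase z : Finset α) : Set α) := by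
    intro x hx
    rw [Finset.coe_erase]
    exact ⟨(mem_coloops.1 (by exact_mod_cast hx.1)).1, hx.2⟩
  exact M.closure_subset_closure hsub hzcl

/-- A set of rank `u` has at most `u` coloops. -/
theorem card_coloops_le {S : Finset α} (hS : S ⊆ gr M) {u : ℕ} (hu : M.eRk (S : Set α) = (u : ℕ∞)) :
    (coloops M S).card ≤ u := by
  have h := (indep_coloops hS).encard_le_eRk_of_subset
    (by exact_mod_cast Finset.filter_subset _ S : ((coloops M S : Finset α) : Set α) ⊆ (S : Set α))
  rw [Set.encard_coe_eq_coe_finsetCard, hu] at h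
  exact_mod_cast h

/-- A bottom set at `(q + 2, q)` has at least two ground elements outside its closure. -/
theorem two_le_card_compl_clF {q : ℕ} {B : Finset α} (hB : B ∈ Uq M (q + 2) q) :
    2 ≤ ((gr M \ clF M B : Finset α)).card := by
  rw [mem_Uq] at hB
  obtain ⟨hBg, hBq, hBc⟩ := hB
  have hclg : clF M B ⊆ gr M := by
    rw [← Finset.coe_subset, coe_clF, coe_gr]
    exact M.closure_subset_ground _
  have hq : M.eRk ((clF M B : Finset α) : Set α) = (q : ℕ∞) := by
    rw [coe_clF, M.eRk_closure_eq, hBq]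
  -- rank of the ground set is at least q + 2
  have hg : ((q + 2 : ℕ) : ℕ∞) ≤ M.eRk ((gr M : Finset α) : Set α) := by
    rw [← hBc]
    exact M.eRk_mono (by exact_mod_cast Finset.sdiff_subset)
  -- submodularity: eRk gr ≤ eRk (clF B) + eRk (gr \ clF B)
  have hunion : ((gr M : Finset α) : Set α) = ((clF M B : Finset α) : Set α) ∪ ((gr M \ clF M B : Finset α) : Set α) := by
    rw [← Finset.coe_union, Finset.union_sdiff_of_subset hclg]
  have hsub : M.eRk ((gr M : Finset α) : Set α) ≤ (q : ℕ∞) + M.eRk ((gr M \ clF M B : Finset α) : Set α) := by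
    rw [hunion, ← hq]
    exact M.eRk_union_le_eRk_add_eRk _ _
  have h2 : (2 : ℕ∞) ≤ M.eRk ((gr M \ clF M B : Finset α) : Set α) := by
    have h' : (q : ℕ∞) + 2 ≤ (q : ℕ∞) + M.eRk ((gr M \ clF M B : Finset α) : Set α) := by
      refine le_trans ?_ hsub
      rw [show ((q + 2 : ℕ) : ℕ∞) = (q : ℕ∞) + 2 by push_cast; rfl] at hg
      exact hg
    exact (ENat.add_le_add_iff_left (ENat.coe_ne_top q)).1 h'
  have h3 := le_trans h2 (M.eRk_le_encard _)
  rw [Set.encard_coe_eq_coe_finsetCard] at h3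
  exact_mod_cast h3

section ELemma

variable {q : ℕ} {𝒜 : Finset (Finset α)} {e : α}

/-- The set `B ∪ {e}` of a bottom set `B` and an element `e ∉ cl B` is a middle-level set at the diagonal. -/
theorem insert_mem_Yq {B : Finset α} (hB : B ∈ Uq M (q + 2) q) (he : e ∈ gr M) (hcl : e ∉ clF M B) :
    insert e B ∈ Yq M (q + 2) q := by
  rw [mem_Uq] at hB
  obtain ⟨hBg, hBq, -⟩ := hB
  have heE : e ∈ M.E \ M.closure (B : Set α) := by
    refine ⟨by rw [← coe_gr]; exact_mod_cast he, ?_⟩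
    rw [← coe_clF]
    exact_mod_cast hcl
  have hr : M.eRk ((insert e B : Finset α) : Set α) = ((q + 1 : ℕ) : ℕ∞) := by
    rw [Finset.coe_insert, Matroid.eRk_insert_eq_add_one heE, hBq]
    push_cast
    rfl
  unfold Yq
  rw [Finset.mem_filter, Finset.mem_powerset, hr]
  refine ⟨Finset.insert_subset he hBg, ?_, ?_⟩
  · exact_mod_cast (by omega : q < q + 1)
  · exact_mod_cast (by omega : q + 1 < q + 2)

/-- A bottom set does not contain an element outside its closure. -/
theorem notMem_of_notMem_clF {p : ℕ} {B : Finset α} (hB : B ∈ Uq M p q) (hcl : e ∉ clF M B) : e ∉ B :=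
  fun h => hcl (subset_clF hB h)

/-- **The e-lemma at the diagonal.**  If some ground element `e` lies outside the closure of every member of
`𝒜 ⊆ Uq M (q + 2) q`, then `𝒜` satisfies the shadow condition with the constant `Φ(q + 2, q) = (q + 2)/(q + 1)`:
the middle-level sets `B ∪ {e}` are pairwise distinct, and the middle-level sets `B ∪ {z}` (`z ∉ cl B`, `z ≠ e`)
avoid `e` and have at most `q + 1` preimages each (a preimage `(B, z)` is determined by the coloop `z` of `S`). -/
theorem shadow_card_of_notMem_closure (h𝒜 : 𝒜 ⊆ Uq M (q + 2) q) (he : e ∈ gr M)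
    (hcl : ∀ B ∈ 𝒜, e ∉ clF M B) :
    ((q + 2 : ℚ) / (q + 1)) * (𝒜.card : ℚ) ≤ ((shadow M (q + 2) q 𝒜).card : ℚ) := by
  classical
  -- part 1: the sets B ∪ {e}
  set P1 : Finset (Finset α) := 𝒜.image (fun B => insert e B) with hP1
  have hP1card : P1.card = 𝒜.card := by
    apply Finset.card_image_of_injOn
    intro B hB B' hB' hBB'
    have h1 : e ∉ B := notMem_of_notMem_clF (h𝒜 hB) (hcl B hB)
    have h2 : e ∉ B' := notMem_of_notMem_clF (h𝒜 hB') (hcl B' hB')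
    have hBB'' : insert e B = insert e B' := hBB'
    calc B = (insert e B).erase e := (Finset.erase_insert h1).symm
      _ = (insert e B').erase e := by rw [hBB'']
      _ = B' := Finset.erase_insert h2
  have hP1sub : P1 ⊆ shadow M (q + 2) q 𝒜 := by
    intro S hS
    rw [hP1, Finset.mem_image] at hS
    obtain ⟨B, hB, rfl⟩ := hS
    rw [mem_shadow]
    exact ⟨insert_mem_Yq (h𝒜 hB) he (hcl B hB), B, hB, Finset.subset_insert _ _⟩
  have hP1e : ∀ S ∈ P1, e ∈ S := by
    intro S hS
    rw [hP1, Finset.mem_image] at hS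
    obtain ⟨B, -, rfl⟩ := hS
    exact Finset.mem_insert_self _ _
  -- part 2: the pairs (B, z), z ∉ cl B, z ≠ e, and the sets B ∪ {z}
  set P : Finset (Σ _ : Finset α, α) := 𝒜.sigma (fun B => (gr M \ clF M B).erase e) with hP
  let f : (Σ _ : Finset α, α) → Finset α := fun x => insert x.2 x.1
  set P2 : Finset (Finset α) := P.image f with hP2
  have hmemP : ∀ x ∈ P, x.1 ∈ 𝒜 ∧ x.2 ∈ gr M ∧ x.2 ∉ clF M x.1 ∧ x.2 ≠ e := by
    intro x hx
    rw [hP, Finset.mem_sigma, Finset.mem_erase, Finset.mem_sdiff] at hx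
    exact ⟨hx.1, hx.2.2.1, hx.2.2.2, hx.2.1⟩
  have hPcard : 𝒜.card ≤ P.card := by
    rw [hP, Finset.card_sigma]
    calc 𝒜.card = ∑ _B ∈ 𝒜, 1 := by simp
      _ ≤ ∑ B ∈ 𝒜, ((gr M \ clF M B).erase e).card := by
          apply Finset.sum_le_sum
          intro B hB
          have h2 := two_le_card_compl_clF (h𝒜 hB)
          have h3 := Finset.pred_card_le_card_erase (s := gr M \ clF M B) (a := e)
          omega
  have hP2sub : P2 ⊆ shadow M (q + 2) q 𝒜 := by
    intro S hS
    rw [hP2, Finset.mem_image] at hS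
    obtain ⟨x, hx, rfl⟩ := hS
    obtain ⟨hx1, hx2, hx3, -⟩ := hmemP x hx
    rw [mem_shadow]
    exact ⟨insert_mem_Yq (h𝒜 hx1) hx2 hx3, x.1, hx1, Finset.subset_insert _ _⟩
  have hP2e : ∀ S ∈ P2, e ∉ S := by
    intro S hS
    rw [hP2, Finset.mem_image] at hS
    obtain ⟨x, hx, rfl⟩ := hS
    obtain ⟨hx1, -, hx3, hx4⟩ := hmemP x hx
    have h1 : e ∉ x.1 := notMem_of_notMem_clF (h𝒜 hx1) (hcl x.1 hx1)
    rw [Finset.mem_insert]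
    rintro (h | h)
    · exact hx4 h.symm
    · exact h1 h
  -- each set of P2 has at most q + 1 preimages
  have hfib : P.card ≤ (q + 1) * P2.card := by
    rw [hP2]
    apply Finset.card_le_mul_card_image
    intro S hS
    rw [Finset.mem_image] at hS
    obtain ⟨x0, hx0, rfl⟩ := hS
    obtain ⟨hx01, hx02, hx03, -⟩ := hmemP x0 hx0
    have hSg : f x0 ⊆ gr M := Finset.insert_subset hx02 (mem_Uq.1 (h𝒜 hx01)).1
    have hSr : M.eRk ((f x0 : Finset α) : Set α) = ((q + 1 : ℕ) : ℕ∞) := by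
      have heE : x0.2 ∈ M.E \ M.closure (x0.1 : Set α) := by
        refine ⟨by rw [← coe_gr]; exact_mod_cast hx02, ?_⟩
        rw [← coe_clF]
        exact_mod_cast hx03
      show M.eRk ((insert x0.2 x0.1 : Finset α) : Set α) = _
      rw [Finset.coe_insert, Matroid.eRk_insert_eq_add_one heE, (mem_Uq.1 (h𝒜 hx01)).2.1]
      push_cast
      rfl
    -- the fibre injects into the coloops of S = f x0 via x ↦ x.2
    have hinj : ((P.filter (fun x => f x = f x0)).card) ≤ (coloops M (f x0)).card := by
      apply Finset.card_le_card_of_injOn (fun x => x.2)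
      · intro x hx
        rw [Finset.coe_filter] at hx
        obtain ⟨hxP, hxf⟩ := hx
        obtain ⟨hx1, -, hx3, -⟩ := hmemP x hxP
        have hzx : x.2 ∉ x.1 := notMem_of_notMem_clF (h𝒜 hx1) hx3
        rw [Finset.mem_coe, mem_coloops]
        refine ⟨?_, ?_⟩
        · rw [← hxf]; exact Finset.mem_insert_self _ _
        · have : (f x0).erase x.2 = x.1 := by
            rw [← hxf]
            exact Finset.erase_insert hzx
          rw [this]
          exact hx3
      · intro x hx y hy hxy
        rw [Finset.coe_filter] at hx hy
        obtain ⟨hxP, hxf⟩ := hx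
        obtain ⟨hyP, hyf⟩ := hy
        obtain ⟨hx1, -, hx3, -⟩ := hmemP x hxP
        obtain ⟨hy1, -, hy3, -⟩ := hmemP y hyP
        have hzx : x.2 ∉ x.1 := notMem_of_notMem_clF (h𝒜 hx1) hx3
        have hzy : y.2 ∉ y.1 := notMem_of_notMem_clF (h𝒜 hy1) hy3
        have hx' : x.1 = (f x0).erase x.2 := by rw [← hxf]; exact (Finset.erase_insert hzx).symm
        have hy' : y.1 = (f x0).erase y.2 := by rw [← hyf]; exact (Finset.erase_insert hzy).symm
        have hxy' : x.2 = y.2 := hxy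
        have h1 : x.1 = y.1 := by rw [hx', hy', hxy']
        exact Sigma.ext h1 (heq_of_eq hxy')
    calc ((P.filter (fun x => f x = f x0)).card) ≤ (coloops M (f x0)).card := hinj
      _ ≤ q + 1 := card_coloops_le hSg hSr
  -- assemble: P1 and P2 are disjoint subsets of the shadow
  have hdisj : Disjoint P1 P2 := by
    rw [Finset.disjoint_left]
    intro S hS1 hS2
    exact hP2e S hS2 (hP1e S hS1)
  have hunion : (P1 ∪ P2).card ≤ (shadow M (q + 2) q 𝒜).card :=
    Finset.card_le_card (Finset.union_subset hP1sub hP2sub)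
  rw [Finset.card_union_of_disjoint hdisj, hP1card] at hunion
  -- arithmetic in ℚ
  have hA : (𝒜.card : ℚ) ≤ ((q : ℚ) + 1) * (P2.card : ℚ) := by
    have : (𝒜.card : ℚ) ≤ ((P.card : ℕ) : ℚ) := by exact_mod_cast hPcard
    have h' : ((P.card : ℕ) : ℚ) ≤ (((q + 1) * P2.card : ℕ) : ℚ) := by exact_mod_cast hfib
    push_cast at h'
    linarith
  have hS : (𝒜.card : ℚ) + (P2.card : ℚ) ≤ ((shadow M (q + 2) q 𝒜).card : ℚ) := by exact_mod_cast hunion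
  have hq1 : (0 : ℚ) < (q : ℚ) + 1 := by positivity
  rw [div_mul_eq_mul_div, div_le_iff₀ hq1]
  nlinarith

end ELemma

end PercRepro.Shadow
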